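import Summits.Parity.BatemanHorn.Theorems.IsogenyRedeiPencilSelmerDictionary
import Literature.NumberTheory.EllipticCurves.TwoIsogenyCasselsParity
import Literature.NumberTheory.EllipticCurves.CasselsTatePairingFunctorial
import HarnessLib

/-!
# Route IsogenyRedei, crux `PencilSelmerDictionary` (stmt-Parity-11584): the dictionary modulo the
# Cassels–Tate pairing (line `toric-node-vacuity-cassels`, stub F decomposed; continuation lead c1)

`Summit.Parity.BatemanHorn.Theses.IsogenyRedei.PencilSelmerDictionary` was landed modulo Cassels' parity
formula for the `2`-isogeny (`PencilSelmerDictionary_of_cassels`, file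
`IsogenyRedeiPencilSelmerDictionary.lean`, hypothesis = the named fact `cassels_selmerCorank_two_parity`).
That named fact is now itself PROVED modulo the Cassels–Tate pairing: the Literature chain
`TwoIsogenyDualKernel` (kernel of the dual `2`-isogeny on `H¹`/`Ш`), `CasselsTateIsogenyParity` (the
`Ш`-part of Cassels' formula from adjoint pairings), `IsogenyPairParityFinite` / `ZpCorankStable` /
`IsogenyPairParity` (the `2`-primary group theory) and `TwoIsogenyCasselsParity`
(`cassels_selmerCorank_two_parity_of_casselsTate_functorial'`) reduce it to the ONE residual named fact
`Literature.NumberTheory.EllipticCurves.casselsTate_pairing_functorial ℚ` — the Cassels–Tate pairing as a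
functorial family (alternating, kernel = divisible subgroup, `⟨φ x, y⟩_{W'} = ⟨x, φ̂ y⟩_W`; Milne, *ADT*,
I, Prop. 6.9, Rem. 6.10(a), Thm. 6.13(a); Silverman, *AEC*, X.4.14, III.6.1), which implies the tree's
`WeierstrassCurve.exists_casselsTate_pairing` and is discharged by the construction of the pairing (Tate
local duality + Poitou–Tate). The theorem below is therefore CONDITIONAL on exactly that fact (D-0014) and
becomes the unconditional proof of the crux the day `casselsTate_pairing_functorial_holds` lands.

[cite: DokchitserDokchitser2011Crelle, Thm. 30 (arXiv:0906.1815)] [cite: MilneADT2006, I Rem. 6.10(a), Thm. 6.13(a)]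
-/

noncomputable section

open scoped Classical

namespace Summit.Parity.BatemanHorn.Theorems.PencilSelmerDictionary

open Literature.NumberTheory.EllipticCurves
open Summit.Parity.BatemanHorn.Theses.IsogenyRedei (PencilSelmerDictionary)

/-- **Cassels' parity formula for the `2`-isogeny from the functorial Cassels–Tate fact** (the tree's
named fact `cassels_selmerCorank_two_parity`, conditionally on `casselsTate_pairing_functorial ℚ`).
[cite: DokchitserDokchitser2011Crelle, Thm. 30 (arXiv:0906.1815)] -/
theorem cassels_selmerCorank_two_parity_of_ctFunctorial (h : casselsTate_pairing_functorial ℚ) :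
    cassels_selmerCorank_two_parity :=
  cassels_selmerCorank_two_parity_of_casselsTate_functorial' h

/-- **`PencilSelmerDictionary` modulo the Cassels–Tate pairing.** Granted the functorial Cassels–Tate
family over `ℚ` (`casselsTate_pairing_functorial ℚ`: Milne, *ADT*, I.6.9, 6.10(a), 6.13(a)), the crux
`PencilSelmerDictionary` holds (with `M = 2`, `w t = if t % 4 < 2 then −1 else 1`): Cassels' parity formula
follows from the pairing (`cassels_selmerCorank_two_parity_of_ctFunctorial`) and the line
`toric-node-vacuity-cassels` does the rest (`PencilSelmerDictionary_of_cassels`).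
[cite: DokchitserDokchitser2011Crelle, Thm. 30 (arXiv:0906.1815)] -/
theorem PencilSelmerDictionary_of_casselsTate_functorial :
    casselsTate_pairing_functorial ℚ → PencilSelmerDictionary := fun h =>
  PencilSelmerDictionary_of_cassels (cassels_selmerCorank_two_parity_of_ctFunctorial h)

end Summit.Parity.BatemanHorn.Theorems.PencilSelmerDictionary

end
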